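import Mathlib
import HarnessLib
import Literature.MathematicalPhysics.KineticTheory.VelocityFlipNoise
import Summits.AtomisticToContinuum.FouriersLaw.Theorems.VanishingNoiseTransferNoisyFourierAbelPairingIdentity
import Summits.AtomisticToContinuum.FouriersLaw.Theorems.VanishingNoiseTransferNoisyFourierFlipCeilingBondResponse

/-!
# The Abel pairing of a test function lives in its pattern defect: `⟨j_i, w⟩ = ⟨E_{≤i}, Xw⟩ = ⟨E_{≤i}, P₀Xw⟩`
# (line `abel-storage-decay`, crux `VanishingNoiseTransfer.NoisyFourier`, stmt-AtomisticToContinuum-11977, stub B)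

`--supports stmt-AtomisticToContinuum-11977` file (worker B of lead c6), companion of the level-`s` Thomson lower bound
(`…NoisyFourierAbelPairingIdentity`, `…NoisyFourierBulkPositivityOfWitnessFamily`). Setting as there: the pinned chain
`𝐏 = pinnedChain ω₂ lam β γ` (parameters `> 0`), `T > 0`, `L ≥ 2`, `μ_T`, the Liouvillian `X = 𝐏.liouvillian L`,
the plain equilibrium generator `L_{T,T} = 𝐏.generator L T T = X + γS_B`, the block energies `E_{≤i} = HardTether.leftEnergy`
(`X E_{≤i} = −j_i`, `liouvilleOp_leftEnergy`) and the pattern average `P₀` (mean over the `2^L` momentum-sign patterns).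

* `integral_mul_bondCurrent_eq_leftEnergy` — for every genuine bond `i` (`i + 1 < L`) and every `w ∈ C²` with
  `w, Xw, L_{T,T}w ∈ L²(μ_T)`: `∫ w j_i dμ_T = ∫ E_{≤i} · Xw dμ_T` (antisymmetry of `X`; here: `pairing_identity` with
  the block energy as an `s = 0`, `ε = 0` "corrector" with source `j_i + γ(p_0² − T)` — `leftEnergy_backwardPair` — and
  Gaussian integration by parts `⟨w, p_0² − T⟩ = T⟨∂_{p_0}w, p_0⟩`).
* `integral_mul_bondCurrent_eq_leftEnergy_pattern` — `= ∫ E_{≤i} · P₀(Xw) dμ_T` (`E_{≤i}` is even in every momentum,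
  `integral_mul_pattern_split`).
* `integral_mul_totalCurrent_eq_pattern` — summed: `∫ w J dμ_T = ∫ G · P₀(Xw) dμ_T`, `G = Σ_{i+1<L} E_{≤i}`, `J = Σ_i j_i`.

Consequence for the witness families of `…BulkPositivityOfWitnessFamily` (recorded, not formalised): the pairing
`⟨J, w⟩` of ANY admissible test function is carried entirely by the pattern component `P₀Xw` that the Thomson bound
charges at `1/s`; exactly half-conserved test functions (`P₀Xw = 0`) pair to zero, and `|⟨J,w⟩| ≤ ‖G − ⟨G⟩‖‖P₀Xw‖`.
* `helper_abelPairingDefect` — registered notation-free restatement of the per-bond identity.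

References: Bonetto–Lebowitz–Rey-Bellet 2000 §5.2 (block energies, all bonds carry the flux); folklore.
No definitions; axioms `propext`, `Classical.choice`, `Quot.sound` only.
-/

noncomputable section

open MeasureTheory Filter Topology
open scoped BigOperators ContDiff
open Literature.MathematicalPhysics.KineticTheory.HeatConduction
open Literature.MathematicalPhysics.KineticTheory.HeatConduction.HardTether (leftEnergy blockWeight partialP_leftEnergy)
open Summit.AtomisticToContinuum.FouriersLaw.Theorems.SuperadditiveResistance.DeviceLiouville (kin kin_eq_sq liouvilleOp bathOp)
open Summit.AtomisticToContinuum.FouriersLaw.Theorems.SuperadditiveResistance.Kubo (memLp_partialP)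
open Summit.AtomisticToContinuum.FouriersLaw.Theorems.SuperadditiveResistance.KuboPlain
  (generator_eq_liouvilleOp_add_bathOp)
open Summit.AtomisticToContinuum.FouriersLaw.Cruxes.SuperadditiveResistance.FloatingProbeBypassLaplacian
  (pinnedChain_memLp_two_snd pinnedChain_memLp_two_snd_sq integral_mul_sq_sub_gibbsMeasure)
open Summit.AtomisticToContinuum.FouriersLaw.Cruxes.SuperadditiveResistance.InsertionToolbox
  (pinnedChain_memLp_two_of_abs_le)
open Summit.AtomisticToContinuum.FouriersLaw.Theorems.VanishingNoiseBound
  (gibbs_flipInvariant contDiff_leftEnergy' leftEnergy_mem_Icc)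
open Summit.AtomisticToContinuum.FouriersLaw.Cruxes.NoisyFourier.AbelKapitzaEvenCorrector.AbelTransfer
  (memLp_patternAverage)
open Summit.AtomisticToContinuum.FouriersLaw.Theorems.NoisyFourier.FlipCeiling
  (liouvilleOp_leftEnergy leftEnergy_backwardPair)

namespace Summit.AtomisticToContinuum.FouriersLaw.Theorems.NoisyFourier.AbelThomson

section Defect

variable {ω₂ lam β γ : ℝ}

/-- The block energy is even in every momentum, hence invariant under every momentum-sign pattern. [folklore] -/
theorem leftEnergy_pattern (P : OscillatorChain) {L : ℕ} (i : Fin L) (σ : Fin L → Bool) (x : PhaseSpace L) :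
    leftEnergy P L i ((x.1, fun k => if σ k then -x.2 k else x.2 k) : PhaseSpace L) = leftEnergy P L i x := by
  unfold leftEnergy
  dsimp only
  congr 1
  refine Finset.sum_congr rfl fun k _ => ?_
  by_cases h : σ k = true <;> simp [h]

/-- Hence `P₀ E_{≤i} = E_{≤i}` pointwise. [folklore] -/
theorem patternAverage_leftEnergy (P : OscillatorChain) {L : ℕ} (i : Fin L) (x : PhaseSpace L) :
    (∑ σ : Fin L → Bool, leftEnergy P L i ((x.1, fun k => if σ k then -x.2 k else x.2 k) : PhaseSpace L)) / 2 ^ L =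
      leftEnergy P L i x := by
  simp only [leftEnergy_pattern, Finset.sum_const, Finset.card_univ, Fintype.card_fun, Fintype.card_bool,
    Fintype.card_fin, nsmul_eq_mul, Nat.cast_pow, Nat.cast_ofNat]
  field_simp

/-- The block energy of a genuine bond as a zero-frequency "corrector" of the plain generator:
`L_{T,T} E_{≤i} = 0·E_{≤i} − (j_i + γ(p_0² − T))`. [Bonetto–Lebowitz–Rey-Bellet 2000, §5.2] [folklore] -/
theorem leftEnergy_zeroCorrector (T : ℝ) {L : ℕ} {i : Fin L} (hi : i.val + 1 < L) (x : PhaseSpace L) :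
    (pinnedChain ω₂ lam β γ).flipGenerator L T T 0 (leftEnergy (pinnedChain ω₂ lam β γ) L i) x =
      0 * leftEnergy (pinnedChain ω₂ lam β γ) L i x -
        ((pinnedChain ω₂ lam β γ).bondCurrent L i x + γ * (kin L 0 x - T)) := by
  have hU : Differentiable ℝ (pinnedChain ω₂ lam β γ).U :=
    (pinnedChain_contDiff_U ω₂ lam β γ (n := 1)).differentiable one_ne_zero
  have hV : Differentiable ℝ (pinnedChain ω₂ lam β γ).V :=
    (pinnedChain_contDiff_V ω₂ lam β γ (n := 1)).differentiable one_ne_zero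
  have hliou := liouvilleOp_leftEnergy (pinnedChain ω₂ lam β γ) hU hV i x
  have hback := leftEnergy_backwardPair (ω₂ := ω₂) (lam := lam) (β := β) (γ := γ) T hi x
  have hgen := generator_eq_liouvilleOp_add_bathOp (pinnedChain ω₂ lam β γ) L T
    (leftEnergy (pinnedChain ω₂ lam β γ) L i) x
  rw [show (pinnedChain ω₂ lam β γ).γ = γ from rfl] at hgen
  rw [OscillatorChain.flipGenerator_zero, hgen]
  linear_combination hback + 2 * hliou

/-- **The pairing of a bond current with a test function is the pairing of the block energy with `Xw`.** For the
pinned chain (parameters `> 0`), `T > 0`, a genuine bond `i` (`i + 1 < L`) and `w ∈ C²` with `w, Xw, L_{T,T}w ∈ L²(μ_T)`: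
`∫ w j_i dμ_T = ∫ E_{≤i} · Xw dμ_T`. [folklore] -/
theorem integral_mul_bondCurrent_eq_leftEnergy (hω : 0 < ω₂) (hl : 0 < lam) (hβ : 0 < β) (hγ : 0 < γ) {T : ℝ}
    (hT : 0 < T) {L : ℕ} {i : Fin L} (hi : i.val + 1 < L) {w : PhaseSpace L → ℝ} (hwC : ContDiff ℝ 2 w)
    (hw2 : MemLp w 2 ((pinnedChain ω₂ lam β γ).gibbsMeasure L T))
    (hXw2 : MemLp ((pinnedChain ω₂ lam β γ).liouvillian L w) 2 ((pinnedChain ω₂ lam β γ).gibbsMeasure L T))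
    (hGw2 : MemLp ((pinnedChain ω₂ lam β γ).generator L T T w) 2 ((pinnedChain ω₂ lam β γ).gibbsMeasure L T)) :
    ∫ x, w x * (pinnedChain ω₂ lam β γ).bondCurrent L i x ∂((pinnedChain ω₂ lam β γ).gibbsMeasure L T) =
      ∫ x, leftEnergy (pinnedChain ω₂ lam β γ) L i x * (pinnedChain ω₂ lam β γ).liouvillian L w x
        ∂((pinnedChain ω₂ lam β γ).gibbsMeasure L T) := by
  have hL0 : 0 < L := by omega
  set P := pinnedChain ω₂ lam β γ with hP
  set μ := P.gibbsMeasure L T with hμdef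
  set E := leftEnergy P L i with hE
  set B := OscillatorChain.bathWeight L with hB
  haveI : IsProbabilityMeasure μ := pinnedChain_isProbabilityMeasure_gibbsMeasure hω hl.le hβ.le γ L hT
  have hB0 : B ⟨0, hL0⟩ = 1 := by
    show ((if (⟨0, hL0⟩ : Fin L).val = 0 then (1 : ℝ) else 0) +
      if (⟨0, hL0⟩ : Fin L).val = L - 1 then (1 : ℝ) else 0) = 1
    rw [if_pos rfl, if_neg (show (⟨0, hL0⟩ : Fin L).val ≠ L - 1 by simp only; omega)]
    ring
  -- regularity and square integrability of the block energy and its source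
  have hU : ContDiff ℝ ∞ P.U := pinnedChain_contDiff_U ω₂ lam β γ
  have hV : ContDiff ℝ ∞ P.V := pinnedChain_contDiff_V ω₂ lam β γ
  have hEs : ContDiff ℝ ∞ E := contDiff_leftEnergy' P hU hV L i
  have hE2 : ContDiff ℝ 2 E := hEs.of_le (by norm_cast)
  have hU0 : ∀ q, 0 ≤ P.U q := fun q => by
    show 0 ≤ ω₂ * q ^ 2 / 2 + lam * q ^ 4 / 4
    positivity
  have hV0 : ∀ r, 0 ≤ P.V r := fun r => by
    show 0 ≤ r ^ 2 / 2 + β * r ^ 4 / 4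
    positivity
  have hEL2 : MemLp E 2 μ :=
    pinnedChain_memLp_two_of_abs_le hω hl.le hβ.le γ L hT hEs.continuous (C := 1) (k := 1) fun x => by
      obtain ⟨h0, h1⟩ := leftEnergy_mem_Icc P hU0 hV0 L i x
      rw [abs_of_nonneg h0, pow_one, one_mul]
      linarith
  have hk0L2 : MemLp (fun x => kin L 0 x - T) 2 μ :=
    ((pinnedChain_memLp_two_snd_sq hω hl.le hβ.le γ L hT ⟨0, hL0⟩).sub (memLp_const T)).ae_eq
      (ae_of_all _ fun x => by simp [kin_eq_sq hL0])
  have hjL2 : MemLp (P.bondCurrent L i) 2 μ :=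
    pinnedChain_memLp_two_of_abs_le hω hl.le hβ.le γ L hT (pinnedChain_continuous_bondCurrent ω₂ lam β γ L i)
      (C := (L : ℝ) * ((3 + β) / 2)) (k := 2) fun x => by
      calc |P.bondCurrent L i x| ≤ L * ((3 + β) / 2 * (1 + P.hamiltonian L x) ^ 2) :=
            pinnedChain_abs_bondCurrent_le hω.le hl.le hβ.le γ L i x
        _ = (L : ℝ) * ((3 + β) / 2) * (1 + P.hamiltonian L x) ^ 2 := by ring
  set JE : PhaseSpace L → ℝ := fun x => P.bondCurrent L i x + γ * (kin L 0 x - T) with hJE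
  have hJE2 : MemLp JE 2 μ := hjL2.add (hk0L2.const_mul γ)
  have hpdeE : ∀ x, P.flipGenerator L T T 0 E x = 0 * E x - JE x := fun x =>
    leftEnergy_zeroCorrector (ω₂ := ω₂) (lam := lam) (β := β) (γ := γ) T hi x
  -- the pairing identity with the block energy in the corrector slot
  have hI := pairing_identity hω hl hβ hγ hT 0 hJE2 hE2 hEL2 hpdeE hwC hw2 hXw2 hGw2
  -- the bath term: only `p_0` enters, `∂_{p_0} E = p_0`
  have hdE : ∀ k : Fin L, partialP k E = fun x => blockWeight i k * x.2 k := fun k => partialP_leftEnergy P i k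
  have hbath : ∑ k, B k * ∫ x, partialP k E x * partialP k w x ∂μ =
      ∫ x, partialP ⟨0, hL0⟩ w x * x.2 ⟨0, hL0⟩ ∂μ := by
    rw [Finset.sum_eq_single ⟨0, hL0⟩]
    · have hw0 : blockWeight i ⟨0, hL0⟩ = 1 := by simp [blockWeight]
      rw [hB0, one_mul, hdE]
      exact integral_congr_ae (ae_of_all _ fun x => by simp only [hw0]; ring)
    · intro k _ hk
      by_cases hkL : k.val = L - 1
      · have hwk : blockWeight i k = 0 := by
          simp only [blockWeight]
          rw [if_neg (by omega)]
        rw [hdE]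
        simp [hwk]
      · have hBk : B k = 0 := by
          have hk0 : k.val ≠ 0 := fun h => hk (Fin.ext h)
          show ((if k.val = 0 then (1 : ℝ) else 0) + if k.val = L - 1 then (1 : ℝ) else 0) = 0
          rw [if_neg hk0, if_neg hkL]
          ring
        rw [hBk, zero_mul]
    · intro h
      exact absurd (Finset.mem_univ _) h
  -- Gaussian integration by parts in `p_0`
  have hwd : Differentiable ℝ w := hwC.differentiable two_ne_zero
  have hB0' : ∀ k, 0 ≤ B k := Literature.MathematicalPhysics.KineticTheory.HeatConduction.bathWeight_nonneg L
  set kw : PhaseSpace L → ℝ := fun x => -P.generator L T T w x with hkw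
  have hkw2 : MemLp kw 2 μ := hGw2.neg
  have hpw : ∀ x, 1 * liouvilleOp P L w x + γ * bathOp L B T w x = -kw x := by
    intro x
    simp only [hkw, neg_neg]
    rw [generator_eq_liouvilleOp_add_bathOp]
    show 1 * liouvilleOp P L w x + γ * bathOp L B T w x = liouvilleOp P L w x + γ * bathOp L B T w x
    ring
  have hBpos : 0 < B ⟨0, hL0⟩ := by
    rw [hB0]
    exact one_pos
  have hdw0 : MemLp (partialP ⟨0, hL0⟩ w) 2 μ := memLp_partialP hω hl.le hβ.le γ L hT B hB0' 1 hγ hwC hw2 hkw2 hpw hBpos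
  have hibp : ∫ x, w x * (kin L 0 x - T) ∂μ = T * ∫ x, partialP ⟨0, hL0⟩ w x * x.2 ⟨0, hL0⟩ ∂μ := by
    rw [← integral_mul_sq_sub_gibbsMeasure hω hl.le hβ.le γ L hT ⟨0, hL0⟩ hwd hw2 hdw0]
    exact integral_congr_ae (ae_of_all _ fun x => by simp [kin_eq_sq hL0])
  -- expand `∫ w JE`
  have hsplit : ∫ x, w x * JE x ∂μ = (∫ x, w x * P.bondCurrent L i x ∂μ) + γ * ∫ x, w x * (kin L 0 x - T) ∂μ := by
    have i1 : Integrable (fun x => w x * P.bondCurrent L i x) μ := hw2.integrable_mul hjL2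
    have i2 : Integrable (fun x => w x * (kin L 0 x - T)) μ := hw2.integrable_mul hk0L2
    rw [← integral_const_mul, ← integral_add i1 (i2.const_mul γ)]
    exact integral_congr_ae (ae_of_all _ fun x => by simp only [hJE]; ring)
  rw [hsplit, hbath, hibp] at hI
  have e0 : (0 : ℝ) / 2 = 0 := by norm_num
  simp only [zero_mul, e0, zero_add] at hI
  linarith

/-- **… and only the pattern component of `Xw` is seen**: `∫ w j_i dμ_T = ∫ E_{≤i} · P₀(Xw) dμ_T` (`E_{≤i}` is even in
every momentum, so `⟨E_{≤i}, (1 − P₀)Xw⟩ = 0`). [folklore] -/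
theorem integral_mul_bondCurrent_eq_leftEnergy_pattern (hω : 0 < ω₂) (hl : 0 < lam) (hβ : 0 < β) (hγ : 0 < γ)
    {T : ℝ} (hT : 0 < T) {L : ℕ} {i : Fin L} (hi : i.val + 1 < L) {w : PhaseSpace L → ℝ} (hwC : ContDiff ℝ 2 w)
    (hw2 : MemLp w 2 ((pinnedChain ω₂ lam β γ).gibbsMeasure L T))
    (hXw2 : MemLp ((pinnedChain ω₂ lam β γ).liouvillian L w) 2 ((pinnedChain ω₂ lam β γ).gibbsMeasure L T))
    (hGw2 : MemLp ((pinnedChain ω₂ lam β γ).generator L T T w) 2 ((pinnedChain ω₂ lam β γ).gibbsMeasure L T)) :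
    ∫ x, w x * (pinnedChain ω₂ lam β γ).bondCurrent L i x ∂((pinnedChain ω₂ lam β γ).gibbsMeasure L T) =
      ∫ x, leftEnergy (pinnedChain ω₂ lam β γ) L i x *
        ((∑ σ : Fin L → Bool, (pinnedChain ω₂ lam β γ).liouvillian L w
          (x.1, fun k => if σ k then -x.2 k else x.2 k)) / 2 ^ L) ∂((pinnedChain ω₂ lam β γ).gibbsMeasure L T) := by
  set P := pinnedChain ω₂ lam β γ with hP
  set μ := P.gibbsMeasure L T with hμdef
  have hflip := gibbs_flipInvariant (ω₂ := ω₂) (lam := lam) (β := β) (γ := γ) L T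
  have hU : ContDiff ℝ ∞ P.U := pinnedChain_contDiff_U ω₂ lam β γ
  have hV : ContDiff ℝ ∞ P.V := pinnedChain_contDiff_V ω₂ lam β γ
  have hEs : ContDiff ℝ ∞ (leftEnergy P L i) := contDiff_leftEnergy' P hU hV L i
  have hU0 : ∀ q, 0 ≤ P.U q := fun q => by
    show 0 ≤ ω₂ * q ^ 2 / 2 + lam * q ^ 4 / 4
    positivity
  have hV0 : ∀ r, 0 ≤ P.V r := fun r => by
    show 0 ≤ r ^ 2 / 2 + β * r ^ 4 / 4
    positivity
  have hEL2 : MemLp (leftEnergy P L i) 2 μ :=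
    pinnedChain_memLp_two_of_abs_le hω hl.le hβ.le γ L hT hEs.continuous (C := 1) (k := 1) fun x => by
      obtain ⟨h0, h1⟩ := leftEnergy_mem_Icc P hU0 hV0 L i x
      rw [abs_of_nonneg h0, pow_one, one_mul]
      linarith
  rw [integral_mul_bondCurrent_eq_leftEnergy hω hl hβ hγ hT hi hwC hw2 hXw2 hGw2,
    integral_mul_pattern_split hflip hEL2 hXw2]
  have h0 : ∫ x, (leftEnergy P L i x -
      (∑ σ : Fin L → Bool, leftEnergy P L i ((x.1, fun k => if σ k then -x.2 k else x.2 k) : PhaseSpace L)) / 2 ^ L) *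
        P.liouvillian L w x ∂μ = 0 := by
    simp [patternAverage_leftEnergy]
  rw [h0, zero_add]
  exact integral_congr_ae (ae_of_all _ fun x => by simp only [patternAverage_leftEnergy])

/-- **The total-current pairing lives in the pattern defect**: `∫ w J dμ_T = ∫ G · P₀(Xw) dμ_T` with
`G = Σ_{i+1<L} E_{≤i}` (the last "bond" carries no current). [folklore] -/
theorem integral_mul_totalCurrent_eq_pattern (hω : 0 < ω₂) (hl : 0 < lam) (hβ : 0 < β) (hγ : 0 < γ) {T : ℝ}
    (hT : 0 < T) {L : ℕ} {w : PhaseSpace L → ℝ} (hwC : ContDiff ℝ 2 w)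
    (hw2 : MemLp w 2 ((pinnedChain ω₂ lam β γ).gibbsMeasure L T))
    (hXw2 : MemLp ((pinnedChain ω₂ lam β γ).liouvillian L w) 2 ((pinnedChain ω₂ lam β γ).gibbsMeasure L T))
    (hGw2 : MemLp ((pinnedChain ω₂ lam β γ).generator L T T w) 2 ((pinnedChain ω₂ lam β γ).gibbsMeasure L T)) :
    ∫ x, w x * (∑ i, (pinnedChain ω₂ lam β γ).bondCurrent L i x) ∂((pinnedChain ω₂ lam β γ).gibbsMeasure L T) =
      ∫ x, (∑ i : Fin L, if i.val + 1 < L then leftEnergy (pinnedChain ω₂ lam β γ) L i x else 0) *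
        ((∑ σ : Fin L → Bool, (pinnedChain ω₂ lam β γ).liouvillian L w
          (x.1, fun k => if σ k then -x.2 k else x.2 k)) / 2 ^ L) ∂((pinnedChain ω₂ lam β γ).gibbsMeasure L T) := by
  set P := pinnedChain ω₂ lam β γ with hP
  set μ := P.gibbsMeasure L T with hμdef
  have hflip := gibbs_flipInvariant (ω₂ := ω₂) (lam := lam) (β := β) (γ := γ) L T
  set pg : PhaseSpace L → ℝ := fun x =>
    (∑ σ : Fin L → Bool, P.liouvillian L w (x.1, fun k => if σ k then -x.2 k else x.2 k)) / 2 ^ L with hpg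
  have hpg2 : MemLp pg 2 μ := memLp_patternAverage hflip hXw2
  have hU : ContDiff ℝ ∞ P.U := pinnedChain_contDiff_U ω₂ lam β γ
  have hV : ContDiff ℝ ∞ P.V := pinnedChain_contDiff_V ω₂ lam β γ
  have hU0 : ∀ q, 0 ≤ P.U q := fun q => by
    show 0 ≤ ω₂ * q ^ 2 / 2 + lam * q ^ 4 / 4
    positivity
  have hV0 : ∀ r, 0 ≤ P.V r := fun r => by
    show 0 ≤ r ^ 2 / 2 + β * r ^ 4 / 4
    positivity
  have hEL2 : ∀ i : Fin L, MemLp (leftEnergy P L i) 2 μ := fun i =>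
    pinnedChain_memLp_two_of_abs_le hω hl.le hβ.le γ L hT (contDiff_leftEnergy' P hU hV L i).continuous
      (C := 1) (k := 1) fun x => by
      obtain ⟨h0, h1⟩ := leftEnergy_mem_Icc P hU0 hV0 L i x
      rw [abs_of_nonneg h0, pow_one, one_mul]
      linarith
  have hjL2 : ∀ i : Fin L, MemLp (P.bondCurrent L i) 2 μ := fun i =>
    pinnedChain_memLp_two_of_abs_le hω hl.le hβ.le γ L hT (pinnedChain_continuous_bondCurrent ω₂ lam β γ L i)
      (C := (L : ℝ) * ((3 + β) / 2)) (k := 2) fun x => by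
      calc |P.bondCurrent L i x| ≤ L * ((3 + β) / 2 * (1 + P.hamiltonian L x) ^ 2) :=
            pinnedChain_abs_bondCurrent_le hω.le hl.le hβ.le γ L i x
        _ = (L : ℝ) * ((3 + β) / 2) * (1 + P.hamiltonian L x) ^ 2 := by ring
  -- termwise
  have hterm : ∀ i : Fin L, ∫ x, w x * P.bondCurrent L i x ∂μ =
      ∫ x, (if i.val + 1 < L then leftEnergy P L i x else 0) * pg x ∂μ := by
    intro i
    by_cases hi : i.val + 1 < L
    · simp only [if_pos hi]
      exact integral_mul_bondCurrent_eq_leftEnergy_pattern hω hl hβ hγ hT hi hwC hw2 hXw2 hGw2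
    · have hlast : i.val + 1 = L := by omega
      simp only [if_neg hi, zero_mul, integral_zero]
      simp [P.bondCurrent_eq_zero_of_last L i hlast]
  have hiw : ∀ i : Fin L, Integrable (fun x => w x * P.bondCurrent L i x) μ := fun i => hw2.integrable_mul (hjL2 i)
  have hiE : ∀ i : Fin L, Integrable (fun x => (if i.val + 1 < L then leftEnergy P L i x else 0) * pg x) μ := by
    intro i
    by_cases hi : i.val + 1 < L
    · simp only [if_pos hi]
      exact (hEL2 i).integrable_mul hpg2
    · simp only [if_neg hi, zero_mul]
      exact integrable_zero _ _ _
  calc ∫ x, w x * (∑ i, P.bondCurrent L i x) ∂μ = ∫ x, ∑ i, w x * P.bondCurrent L i x ∂μ :=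
        integral_congr_ae (ae_of_all _ fun x => by simp only [Finset.mul_sum])
    _ = ∑ i, ∫ x, w x * P.bondCurrent L i x ∂μ := integral_finsetSum _ fun i _ => hiw i
    _ = ∑ i, ∫ x, (if i.val + 1 < L then leftEnergy P L i x else 0) * pg x ∂μ := Finset.sum_congr rfl fun i _ => hterm i
    _ = ∫ x, ∑ i, (if i.val + 1 < L then leftEnergy P L i x else 0) * pg x ∂μ :=
        (integral_finsetSum _ fun i _ => hiE i).symm
    _ = ∫ x, (∑ i : Fin L, if i.val + 1 < L then leftEnergy P L i x else 0) * pg x ∂μ :=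
        integral_congr_ae (ae_of_all _ fun x => by simp only [Finset.sum_mul])

end Defect

/-! ## Registered helper (notation-free restatement) -/

/-- Registered helper sub-goal `helper_abelPairingDefect` of crux stmt-AtomisticToContinuum-11977 (line `abel-storage-decay`,
stub B `stub_bulkAbelGKPositivity`): the pairing of a genuine bond current with an admissible test function is the pairing
of the block energy with the PATTERN component of `Xw` (`integral_mul_bondCurrent_eq_leftEnergy_pattern`, restated).
[folklore] -/
theorem helper_abelPairingDefect : ∀ (ω₂ lam β γ T : ℝ), 0 < ω₂ → 0 < lam → 0 < β → 0 < γ → 0 < T → ∀ (L : ℕ) (i : Fin L), i.val + 1 < L → ∀ (w : Literature.MathematicalPhysics.KineticTheory.HeatConduction.PhaseSpace L → ℝ), ContDiff ℝ 2 w → MeasureTheory.MemLp w 2 ((Literature.MathematicalPhysics.KineticTheory.HeatConduction.pinnedChain ω₂ lam β γ).gibbsMeasure L T) → MeasureTheory.MemLp ((Literature.MathematicalPhysics.KineticTheory.HeatConduction.pinnedChain ω₂ lam β γ).liouvillian L w) 2 ((Literature.MathematicalPhysics.KineticTheory.HeatConduction.pinnedChain ω₂ lam β γ).gibbsMeasure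 L T) → MeasureTheory.MemLp ((Literature.MathematicalPhysics.KineticTheory.HeatConduction.pinnedChain ω₂ lam β γ).generator L T T w) 2 ((Literature.MathematicalPhysics.KineticTheory.HeatConduction.pinnedChain ω₂ lam β γ).gibbsMeasure L T) → MeasureTheory.integral ((Literature.MathematicalPhysics.KineticTheory.HeatConduction.pinnedChain ω₂ lam β γ).gibbsMeasure L T) (fun x => w x * (Literature.MathematicalPhysics.KineticTheory.HeatConduction.pinnedChain ω₂ lam β γ).bondCurrent L i x) = MeasureTheory.integral ((Literature.MathematicalPhysics.KineticTheory.HeatConduction.pinnedChain ω₂ lam β γ).gibbsMeasure L T) (fun x => Literature.MathematicalPhysics.KineticTheory.HeatConduction.HardTether.leftEnergy (Literature.MathematicalPhysics.KineticTheory.HeatConduction.pinnedChain ω₂ lam β γ) L i x * ((∑ σ : Fin L → Bool, (Literature.MathematicalPhysics.KineticTheory.HeatConduction.pinnedChain ω₂ lam β γ).liouvillian L w (x.1, fun k => if σ k then -x.2 k else x.2 k)) / 2 ^ L)) :=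
  fun _ _ _ _ _ hω hl hβ hγ hT _ _ hi _ hwC hw2 hXw2 hGw2 =>
    integral_mul_bondCurrent_eq_leftEnergy_pattern hω hl hβ hγ hT hi hwC hw2 hXw2 hGw2

end Summit.AtomisticToContinuum.FouriersLaw.Theorems.NoisyFourier.AbelThomson

end
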